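import Summits.CriticalPhenomena.PercolationContinuityZ3.Theorems.PercNearOneGluingNoHeavyLowerTailRefinedRowR3Switching
import Summits.CriticalPhenomena.PercolationContinuityZ3.Theorems.PercNearOneGluingNoHeavyLowerTailRefinedRowR2FourFunctions
import Mathlib.Tactic.Linarith
import HarnessLib

/-!
# `NoHeavyLowerTail` (stmt-CriticalPhenomena-4575) — the separating-cluster row R1: WALL TRANSPORT along the
# Ahlswede–Daykin lattice, the hub cells of the reduction `R1 ⟸ (SPLIT)`, and two proved companions of R1 / (SPLIT)

Support file (prover prim-gen-kcluster gen 37; `--supports stmt-CriticalPhenomena-4575`).  No named facts, no sorries.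

Setting (KCLUSTER-gen32 §4, KCLUSTER-gen37 §1 of run/shared/lean/prim/prim-gen-kcluster/): Bernoulli bond percolation with
arbitrary edge probabilities on the support `D ⊆ Sym2 V`, configurations `X ⊆ D`, masses `PrW D p`, `cl X v` the open cluster of
`v`, `RefinedRowR3.Sep D W u v` = the vertex set `W` meets every `u–v` path of the support.  The open refined row is
R1: `u_b u_c ≥ t s_a`.  KCLUSTER-gen37 §1 reduces R1 (by a van den Berg–Kahn style induction with the four functions theorem) to
the hub inequality (SPLIT) on the four HUB CELLS of an apex `a`, a terminal `c` and a vertex set `S` (all inside "`cl X a` hits `S`"):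
`IN` (`c ∈ cl X a`), `HANG` (`c ∉ cl X a`, `c ~ s` for some `s ∈ S`), `WALL` (every `S–c` path of the support meets `cl X a`),
`LOOSE` (the rest);  (SPLIT): `PrW(WALL)·PrW(HANG) ≤ PrW(IN)·PrW(LOOSE)` — OPEN (census-clean, KCLUSTER-gen37 §0.2).

This file puts the hub cells in the tree and proves the part of the picture that the Ahlswede–Daykin lattice gives for free,
the **wall transport** principle (KCLUSTER-gen37 §1.7): if `cl X a` meets every `s–c` path of the support and `c ∈ cl Y s` for a
configuration `Y ⊆ D`, then the `Y`-cluster of `s` meets `cl X a` (`exists_mem_cl_of_sep`); consequently walls survive joins: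
* `pointwise_transport_R1` / **`r1_transport_PrW`**: `PrW(S_a) · PrW(b ~ c) ≤ PrW(b ≁ c) · PrW(T)` — (★★) of the memo, a proved
  companion of R1 (`S_a, T` = gen 32's refined cells `RefinedRowR3.cellSa`, `RefinedRowR2.cellT`);
* `pointwise_transport_split` / **`split_transport_PrW`**: `PrW(WALL) · PrW(hit ∧ (c ~ a ∨ c ~ S)) ≤ PrW(c ≁ a ∧ c ≁ S) · PrW(IN)` —
  (★′) of the memo, i.e. `WALL·(IN + HANG) ≤ IN·(WALL + LOOSE + N₁)` with `N₁ = PrW(¬hit ∧ c ≁ a ∧ c ≁ S)`: (SPLIT) up to the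
  additive defect `IN·N₁` (monotone couplings cannot remove it, KCLUSTER-gen37 §1.7).
Both by `RefinedRowR2.PrW_fourEvents` [cite: AhlswedeDaykin1978, Theorem 1] with a pointwise lattice premise.
-/

noncomputable section

namespace Summit.CriticalPhenomena.PercolationContinuityZ3.Theorems

namespace RefinedRowR1

open Finset Literature.Probability.Percolation Literature.Probability.Percolation.DecisionTree
open Literature.Probability.Percolation.Gladkov ThreePointLB RefinedRowR3 RefinedRowR2
open scoped Classical

variable {V : Type*} [Fintype V] [DecidableEq V]

/-! ### Wall transport -/

/-- **Wall transport.** If the vertex set `K` meets every `s–c` path of the support (`Sep D K s c`) and `c` lies in the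
`Y`-cluster of `s` for a configuration `Y ⊆ D`, then that cluster meets `K`. [this work] -/
theorem exists_mem_cl_of_sep {D Y : Finset (Sym2 V)} {K : Finset V} {s c : V} (hYD : Y ⊆ D) (hsep : Sep D K s c)
    (hc : c ∈ cl Y s) : ∃ v ∈ cl Y s, v ∈ K := by
  by_contra h
  push Not at h
  exact hsep (cl_subset_cl_sdiff_touch hYD h hc)

/-- Wall transport to a bigger configuration: if `cl X a` meets every `s–c` path of the support, `X ⊆ Z`, `Y ⊆ Z`,
`Y ⊆ D`, and `c ∈ cl Y s`, then `s, c ∈ cl Z a`. [this work] -/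
theorem mem_cl_of_sep_of_subset {D X Y Z : Finset (Sym2 V)} {a s c : V} (hYD : Y ⊆ D) (hXZ : X ⊆ Z) (hYZ : Y ⊆ Z)
    (hsep : Sep D (cl X a) s c) (hc : c ∈ cl Y s) : s ∈ cl Z a ∧ c ∈ cl Z a := by
  obtain ⟨v, hvs, hva⟩ := exists_mem_cl_of_sep hYD hsep hc
  have hav : v ∈ cl Z a := cl_mono hXZ a hva
  have hvs' : s ∈ cl Z v := cl_mono hYZ v (mem_cl_comm.1 hvs)
  have hsZ : s ∈ cl Z a := mem_cl_trans hav hvs'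
  exact ⟨hsZ, mem_cl_trans hsZ (cl_mono hYZ s hc)⟩

/-! ### (★★): `s_a · P(b ~ c) ≤ P(b ≁ c) · t` -/

section R1Transport

variable (b c : V)

/-- `b ~ c`: `c` lies in the cluster of `b`. [this work] -/
def connBC : Set (Finset (Sym2 V)) := {X | c ∈ cl X b}

/-- `b ≁ c`. [this work] -/
def apartBC : Set (Finset (Sym2 V)) := {X | c ∉ cl X b}

variable {b c}

omit [DecidableEq V] in
/-- Membership in `connBC`. [this work] -/
@[simp] theorem mem_connBC {X : Finset (Sym2 V)} : X ∈ connBC b c ↔ c ∈ cl X b := Iff.rfl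
omit [DecidableEq V] in
/-- Membership in `apartBC`. [this work] -/
@[simp] theorem mem_apartBC {X : Finset (Sym2 V)} : X ∈ apartBC b c ↔ c ∉ cl X b := Iff.rfl

/-- **Pointwise lattice lemma for (★★)**: for `X ∈ S_a` and `Y` with `b ~ c` (both inside the support),
`X ∩ Y ∈ {b ≁ c}` and `X ∪ Y ∈ T`. [this work] -/
theorem pointwise_transport_R1 {D : Finset (Sym2 V)} {a : V} {X Y : Finset (Sym2 V)} (hYD : Y ⊆ D)
    (hX : X ∈ cellSa D a b c) (hY : Y ∈ connBC b c) : X ∩ Y ∈ apartBC b c ∧ X ∪ Y ∈ cellT a b c := by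
  obtain ⟨⟨_, _, hbc⟩, hsep⟩ := hX
  refine ⟨fun h => hbc (cl_mono Finset.inter_subset_left b h), ?_⟩
  exact mem_cl_of_sep_of_subset hYD Finset.subset_union_left Finset.subset_union_right hsep hY

variable (D : Finset (Sym2 V)) {p : Sym2 V → ℝ} (hp0 : ∀ e, 0 ≤ p e) (hp1 : ∀ e, p e ≤ 1) (a b c : V)
include hp0 hp1

/-- **(★★)** (KCLUSTER-gen37 §1.7): on every finite weighted graph `PrW(S_a) · PrW(b ~ c) ≤ PrW(b ≁ c) · PrW(T)`, i.e.
`s_a · P(b ~ c) ≤ t · P(b ≁ c)` — the separating cell is controlled by the all-joined cell through the odds of `b ~ c`. [this work] -/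
theorem r1_transport_PrW :
    PrW D p (cellSa D a b c) * PrW D p (connBC b c) ≤ PrW D p (apartBC b c) * PrW D p (cellT a b c) :=
  PrW_fourEvents D hp0 hp1 _ _ _ _ fun _ _ _ hT h1 h2 => pointwise_transport_R1 hT h1 h2

end R1Transport

/-! ### The hub cells of (SPLIT) and (★′) -/

section Hub

variable (D : Finset (Sym2 V)) (a c : V) (S : Finset V)

/-- `hit`: the cluster of the apex meets the hub `S`. [this work] -/
def hit : Set (Finset (Sym2 V)) := {X | ∃ s ∈ S, s ∈ cl X a}

/-- `IN`: the cluster of `a` meets `S` and contains `c`. [this work] -/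
def cellIn : Set (Finset (Sym2 V)) := {X | X ∈ hit a S ∧ c ∈ cl X a}

/-- `HANG`: the cluster of `a` meets `S`, misses `c`, and `c` hangs on the hub (`c ~ s` for some `s ∈ S`). [this work] -/
def cellHang : Set (Finset (Sym2 V)) := {X | X ∈ hit a S ∧ c ∉ cl X a ∧ ∃ s ∈ S, c ∈ cl X s}

/-- `WALL`: the cluster of `a` meets `S`, misses `c`, and meets every `S–c` path of the support. [this work] -/
def cellWall : Set (Finset (Sym2 V)) :=
  {X | X ∈ hit a S ∧ c ∉ cl X a ∧ ∀ s ∈ S, s ∈ cl X a ∨ Sep D (cl X a) s c}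

/-- `c` detached from the apex and from the hub: `c ≁ a` and `c ≁ s` for all `s ∈ S`. [this work] -/
def detached : Set (Finset (Sym2 V)) := {X | c ∉ cl X a ∧ ∀ s ∈ S, c ∉ cl X s}

/-- `LOOSE`: hit, `c` detached, and not walled. [this work] -/
def cellLoose : Set (Finset (Sym2 V)) := {X | X ∈ hit a S ∧ X ∈ detached a c S ∧ X ∉ cellWall D a c S}

/-- `hit` and `c` attached to the apex or to the hub (= `IN ∪ HANG`). [this work] -/
def attached : Set (Finset (Sym2 V)) := {X | X ∈ hit a S ∧ (c ∈ cl X a ∨ ∃ s ∈ S, c ∈ cl X s)}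

variable {D a c S}

omit [DecidableEq V] in
/-- Membership in `hit`. [this work] -/
@[simp] theorem mem_hit {X : Finset (Sym2 V)} : X ∈ hit a S ↔ ∃ s ∈ S, s ∈ cl X a := Iff.rfl
omit [DecidableEq V] in
/-- Membership in `cellIn`. [this work] -/
@[simp] theorem mem_cellIn {X : Finset (Sym2 V)} : X ∈ cellIn a c S ↔ X ∈ hit a S ∧ c ∈ cl X a := Iff.rfl
/-- Membership in `cellWall`. [this work] -/
@[simp] theorem mem_cellWall {X : Finset (Sym2 V)} :
    X ∈ cellWall D a c S ↔ X ∈ hit a S ∧ c ∉ cl X a ∧ ∀ s ∈ S, s ∈ cl X a ∨ Sep D (cl X a) s c := Iff.rfl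
omit [DecidableEq V] in
/-- Membership in `detached`. [this work] -/
@[simp] theorem mem_detached {X : Finset (Sym2 V)} : X ∈ detached a c S ↔ c ∉ cl X a ∧ ∀ s ∈ S, c ∉ cl X s := Iff.rfl
omit [DecidableEq V] in
/-- Membership in `attached`. [this work] -/
@[simp] theorem mem_attached {X : Finset (Sym2 V)} :
    X ∈ attached a c S ↔ X ∈ hit a S ∧ (c ∈ cl X a ∨ ∃ s ∈ S, c ∈ cl X s) := Iff.rfl

omit [DecidableEq V] in
/-- `hit` is monotone. [this work] -/
theorem hit_mono {X Z : Finset (Sym2 V)} (hXZ : X ⊆ Z) (hX : X ∈ hit a S) : Z ∈ hit a S := by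
  obtain ⟨s, hs, hsa⟩ := hX
  exact ⟨s, hs, cl_mono hXZ a hsa⟩

/-- A walled configuration is detached: if `cl X a` meets every `S–c` path and misses `c`, then `c ≁ s` for every `s ∈ S`.
[this work] -/
theorem detached_of_wall {X : Finset (Sym2 V)} (hXD : X ⊆ D) (hX : X ∈ cellWall D a c S) : X ∈ detached a c S := by
  obtain ⟨_, hca, hw⟩ := hX
  refine ⟨hca, fun s hs hcs => ?_⟩
  rcases hw s hs with hsa | hsep
  · exact hca (mem_cl_trans hsa hcs)
  · exact hca (mem_cl_of_sep_of_subset hXD subset_rfl subset_rfl hsep hcs).2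

/-- **Pointwise lattice lemma for (★′)**: for `X ∈ WALL` and `Y` hit and attached (both inside the support),
`X ∩ Y` is detached and `X ∪ Y ∈ IN`. [this work] -/
theorem pointwise_transport_split {X Y : Finset (Sym2 V)} (hXD : X ⊆ D) (hYD : Y ⊆ D)
    (hX : X ∈ cellWall D a c S) (hY : Y ∈ attached a c S) : X ∩ Y ∈ detached a c S ∧ X ∪ Y ∈ cellIn a c S := by
  have hdet := detached_of_wall hXD hX
  obtain ⟨hXhit, hca, hw⟩ := hX
  obtain ⟨_, hatt⟩ := hY
  refine ⟨⟨fun h => hdet.1 (cl_mono Finset.inter_subset_left a h),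
    fun s hs h => hdet.2 s hs (cl_mono Finset.inter_subset_left s h)⟩, hit_mono Finset.subset_union_left hXhit, ?_⟩
  rcases hatt with hcY | ⟨s, hs, hcs⟩
  · exact cl_mono Finset.subset_union_right a hcY
  · rcases hw s hs with hsa | hsep
    · exact mem_cl_trans (cl_mono Finset.subset_union_left a hsa) (cl_mono Finset.subset_union_right s hcs)
    · exact (mem_cl_of_sep_of_subset hYD Finset.subset_union_left Finset.subset_union_right hsep hcs).2

variable (D : Finset (Sym2 V)) {p : Sym2 V → ℝ} (hp0 : ∀ e, 0 ≤ p e) (hp1 : ∀ e, p e ≤ 1) (a c : V) (S : Finset V)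
include hp0 hp1

/-- **(★′)** (KCLUSTER-gen37 §1.7): `PrW(WALL) · PrW(hit ∧ attached) ≤ PrW(detached) · PrW(IN)`, i.e.
`WALL · (IN + HANG) ≤ IN · (WALL + LOOSE + N₁)` with `N₁ = PrW(¬hit ∧ detached)` — the Ahlswede–Daykin shadow of (SPLIT). [this work] -/
theorem split_transport_PrW :
    PrW D p (cellWall D a c S) * PrW D p (attached a c S) ≤ PrW D p (detached a c S) * PrW D p (cellIn a c S) :=
  PrW_fourEvents D hp0 hp1 _ _ _ _ fun _ hS _ hT h1 h2 => pointwise_transport_split hS hT h1 h2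

end Hub

end RefinedRowR1

end Summit.CriticalPhenomena.PercolationContinuityZ3.Theorems

end
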